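import Summits.BirchSwinnertonDyer.Rank1Residual.X2.IsogenyLineTypeGoodOrdinary
import Summits.BirchSwinnertonDyer.Rank1Residual.X2.IsogenyQuotientLine
import Literature.NumberTheory.EllipticCurves.KenkuMinimalLevels
import Literature.NumberTheory.EllipticCurves.IsogenyClassFiniteProofs
import HarnessLib

/-!
# `Γ_ℚ`-stable cyclic subgroups of an elliptic curve over `ℚ`: quotients onto globally minimal
# models, bounded order, and the image of `E[p]` modulo an unramified line

Cell `bsd-eis` (FULL-BSD rank-≤1 programme, row A1; home `run/shared/lean/pub/bsd-eis/`), seat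
`bsd-eis-ky` (prover, Keller–Yin verification) gen 3, memo `HOME/bsd-eis-ky-MEMO-3.md` §5 R2. This
file holds the KERNEL-PROVED ingredients of the existence of Keller–Yin's "good lattice" in every
isogeny class of class X1 (`X1/GoodLatticeExists.lean`, which discharges the cited fact
`Literature.NumberTheory.EllipticCurves.ribet_exists_isIsogenous_noUnramifiedLine`):

* §1 `isRationalLine_range_and_not_unramified_of_ker` — for an equivariant `g : E[p] → E'[p]` with
  `#E[p] = p²` whose kernel is an UNRAMIFIED line, at a prime `p` where `E` carries a reduction-line
  datum (good ordinary `p > 2`: `X2.IsogenyLineTypeGoodOrdinary.exists_reductionLine_adicCompletionPrime`),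
  the image `g(E[p])` is a rational line of `E'` which is NOT unramified at `p` (parity-free variant of
  `X2.IsogenyLineType.isRationalLine_range_and_ramified_even_of_ker`; same proof: the unramified kernel
  meets the ramified reduction line trivially, so the reduction line maps isomorphically onto the image).
* §2 `exists_minimal_isogeny_ker_eq` — quotient by a finite `Γ_ℚ`-stable subgroup onto a GLOBALLY
  MINIMAL model (Silverman *AEC* III.4.12 / Rem. III.4.13.2 = tree
  `exists_isogeny_ker_eq_and_comp_eq_nsmul_holds`, Néron VIII.8.3 = `hasGlobalMinimalModel_rat_holds`,
  `VariableChange.toIsogeny`); `degree_eq_addOrderOf_of_ker_eq`, `degree_cast`.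
* §3 `bddAbove_setOf_stableCyclic` — the orders `p^k` of `Γ_ℚ`-stable cyclic subgroups `ℤx ⊂ E(ℚ̄)`
  are BOUNDED: the quotients `E/ℤx` fall into the finitely many `ℚ`-isomorphism classes of the isogeny
  class (Shafarevich, *AEC* IX.6.2 = tree `finite_isogenyClass_holds`), and two cyclic `ℚ`-isogenies
  onto the same curve have equal degree (`degree_eq_of_isCyclic`, from `End_ℚ(E) = ℤ`).
* §4 `eq_of_prime_card_of_mem`, `exists_generator_of_prime_card` — subgroups of prime order.

Everything here is proved in the kernel from tree theorems; no named fact is taken as a hypothesis.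

## References
* [SilvermanAEC2009] J. H. Silverman, *The Arithmetic of Elliptic Curves*, 2nd ed., III.4.12,
  III.4.13.2, VIII.8.3, IX.6.2.
* [KellerYin2024] T. Keller, M. Yin, arXiv:2402.12781v2, Prop. 1.3.1, §1.4 (the good lattice).
* HOME/bsd-eis-ky-MEMO-3.md §5 R2 (plan of this proof).
-/

set_option autoImplicit false

noncomputable section

open scoped Classical

open WeierstrassCurve NumberField IsDedekindDomain Literature.NumberTheory.EllipticCurves
  Literature.NumberTheory.EllipticCurves.Rank1Residual
  Literature.NumberTheory.GaloisRepresentations Field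
  Summit.BirchSwinnertonDyer.Rank1Residual.X2.IsogenyLineType
  Summit.BirchSwinnertonDyer.Rank1Residual.X2.IsogenyLineTypeGoodOrdinary

namespace Summit.BirchSwinnertonDyer.Rank1Residual.X1.StableCyclicQuotient

variable {W W' : WeierstrassCurve ℚ} {p : ℕ} [hp : Fact p.Prime]

/-! ## §1 The image of `E[p]` modulo an UNRAMIFIED line is a RAMIFIED rational line (parity-free) -/

omit hp in
/-- Two subgroups of the same prime order sharing a non-zero element coincide (each is generated by
that element). [folklore] -/
theorem eq_of_prime_card_of_mem {A : Type*} [AddCommGroup A] {p : ℕ} [Fact p.Prime]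
    {H₁ H₂ : AddSubgroup A} (h₁ : Nat.card H₁ = p) (h₂ : Nat.card H₂ = p) {x : A} (hx0 : x ≠ 0)
    (hx₁ : x ∈ H₁) (hx₂ : x ∈ H₂) : H₁ = H₂ := by
  have hp : p.Prime := Fact.out
  -- the order of `x` is `p`
  have hord : addOrderOf x = p := by
    haveI : Finite H₁ := Nat.finite_of_card_ne_zero (by rw [h₁]; exact hp.ne_zero)
    have hdvd : addOrderOf (⟨x, hx₁⟩ : H₁) ∣ p := by rw [← h₁]; exact addOrderOf_dvd_natCard _
    rw [AddSubgroup.addOrderOf_mk] at hdvd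
    rcases (Nat.dvd_prime hp).mp hdvd with h | h
    · exact absurd (AddMonoid.addOrderOf_eq_one_iff.mp h) hx0
    · exact h
  have key : ∀ {H : AddSubgroup A}, Nat.card H = p → x ∈ H → AddSubgroup.zmultiples x = H := by
    intro H hH hxH
    haveI : Finite H := Nat.finite_of_card_ne_zero (by rw [hH]; exact hp.ne_zero)
    exact AddSubgroup.eq_of_le_of_card_ge ((AddSubgroup.zmultiples_le_of_mem hxH))
      (by rw [hH, Nat.card_zmultiples, hord])
  rw [← key h₁ hx₁, key h₂ hx₂]

/-- **Parity-free half of `X2.IsogenyLineType.isRationalLine_range_and_ramified_even_of_ker`.** Let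
`g : E[p] → E'[p]` be `Γ_ℚ`-equivariant with kernel of order `p` UNRAMIFIED at `p`, `#E[p] = p²`, and
suppose (hL₀) that at some prime `𝔓 ∣ p` there is a line `L ≤ E[p]` with `(σ − 1)E[p] ⊆ L` for every
`σ ∈ I_𝔓` and some `σ ∈ I_𝔓` moving a point of `L` (the reduction line at a good ordinary `p`,
`exists_reductionLine_adicCompletionPrime`). Then `g(E[p])` is a rational line of `E'` which is NOT
unramified at `p`: for `P ∈ L` with `σP ≠ P`, `σP − P ∈ L ∖ 0`; if it lay in `ker g` then
`ker g = L` (two lines sharing a non-zero point), contradicting `ker g` unramified; so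
`σ·g(P) ≠ g(P)`. [cite: GreenbergVatsal2000, §2 p. 28 (E' = E/Φ: the image line is ramified)] -/
theorem isRationalLine_range_and_not_unramified_of_ker
    (g : geomTorsion W (p : ℤ) →+ geomTorsion W' (p : ℤ))
    (hg : ∀ (σ : absoluteGaloisGroup ℚ) (P : geomTorsion W (p : ℤ)), g (σ • P) = σ • g P)
    (hE : Nat.card (geomTorsion W (p : ℤ)) = p ^ 2)
    (hL₀ : ∃ (v : HeightOneSpectrum (𝓞 ℚ)), (p : 𝓞 ℚ) ∈ v.asIdeal ∧ ∃ 𝔓 ∈ v.primesAbove,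
      ∃ L : AddSubgroup (geomTorsion W (p : ℤ)), Nat.card L = p ∧
        (∀ σ ∈ 𝔓.inertia (absoluteGaloisGroup ℚ), ∀ P : geomTorsion W (p : ℤ), σ • P - P ∈ L) ∧
        (∃ σ ∈ 𝔓.inertia (absoluteGaloisGroup ℚ), ∃ P ∈ L, σ • P ≠ P))
    (hK : Nat.card g.ker = p) (hu : LineUnramifiedAt W p g.ker) :
    IsRationalLine W' p g.range ∧ ¬ LineUnramifiedAt W' p g.range := by
  refine ⟨isRationalLine_range g hg hE hK, fun hun ↦ ?_⟩
  obtain ⟨v, hv, 𝔓, h𝔓, L, hLcard, hLsub, σ, hσ, P, hPL, hσP⟩ := hL₀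
  have hd : σ • P - P ∈ L := hLsub σ hσ P
  have hd0 : σ • P - P ≠ 0 := sub_ne_zero.mpr hσP
  by_cases hker : σ • P - P ∈ g.ker
  · -- then `ker g = L`, and `ker g` is unramified: contradiction with `σP ≠ P`
    have hKL : g.ker = L := eq_of_prime_card_of_mem hK hLcard hd0 hker hd
    exact hσP (hu v hv 𝔓 h𝔓 σ hσ P (hKL ▸ hPL))
  · -- else `σ` moves `g P ∈ g(E[p])`: contradiction with `g(E[p])` unramified
    have hne : σ • g P ≠ g P := by
      intro h
      apply hker
      rw [AddMonoidHom.mem_ker, map_sub, hg, h, sub_self]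
    exact hne (hun v hv 𝔓 h𝔓 σ hσ (g P) ⟨P, rfl⟩)


/-! ## §2 Quotients by finite stable subgroups, and the degree of a cyclic quotient -/

section Quotient

variable {V : WeierstrassCurve ℚ} [V.IsElliptic]

/-- **Quotient by a finite `Γ_ℚ`-stable subgroup, onto a globally minimal model** (Silverman AEC
III.4.12 / Rem. III.4.13.2 — tree `exists_isogeny_ker_eq_and_comp_eq_nsmul_holds` — followed by Néron's
global minimal model, `hasGlobalMinimalModel_rat_holds`, and the change of variables as an isogeny,
`VariableChange.toIsogeny`; verbatim the argument of `X2.IsogenyQuotientLine.exists_isogeny_ker_eq_line`).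
[cite: SilvermanAEC2009, Prop. III.4.12 with Rem. III.4.13.2] -/
theorem exists_minimal_isogeny_ker_eq (S : AddSubgroup V.geomPoints) (hSfin : (S : Set V.geomPoints).Finite)
    (hSstab : ∀ (σ : absoluteGaloisGroup ℚ) (P : V.geomPoints), P ∈ S → σ • P ∈ S) :
    ∃ (W : WeierstrassCurve ℚ) (_ : W.IsElliptic) (_ : W.IsGloballyMinimal) (g : Isogeny V W),
      g.toAddMonoidHom.ker = S := by
  obtain ⟨W₀, hW₀, g₀, -, hker, -, -⟩ := V.exists_isogeny_ker_eq_and_comp_eq_nsmul_holds S hSfin hSstab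
  obtain ⟨C, hC⟩ := hasGlobalMinimalModel_rat_holds W₀
  refine ⟨C • W₀, inferInstance, hC, (VariableChange.toIsogeny W₀ C).comp g₀, ?_⟩
  rw [Isogeny.ker_comp, VariableChange.ker_toIsogeny, AddMonoidHom.comap_bot, hker]

omit [V.IsElliptic] in
/-- The degree of an isogeny with kernel `ℤ·x` is the order of `x`; such an isogeny is cyclic.
[folklore] -/
theorem degree_eq_addOrderOf_of_ker_eq {W : WeierstrassCurve ℚ} (g : Isogeny V W) {x : V.geomPoints}
    (hker : g.toAddMonoidHom.ker = AddSubgroup.zmultiples x) :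
    g.degree = addOrderOf x ∧ g.IsCyclic := by
  refine ⟨?_, ?_⟩
  · unfold Isogeny.degree; rw [hker, Nat.card_zmultiples]
  · unfold Isogeny.IsCyclic; rw [hker]; infer_instance

omit [V.IsElliptic] in
/-- Transport of an isogeny along an equality of targets keeps degree and cyclicity. [folklore] -/
theorem degree_cast {W₁ W₂ : WeierstrassCurve ℚ} (h : W₁ = W₂) (ψ : Isogeny V W₁) :
    (h ▸ ψ).degree = ψ.degree ∧ ((h ▸ ψ).IsCyclic ↔ ψ.IsCyclic) := by
  subst h; exact ⟨rfl, Iff.rfl⟩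

end Quotient

/-! ## §3 The stable cyclic subgroups through an unramified line have bounded order -/

section Bounded

variable {V : WeierstrassCurve ℚ} [V.IsElliptic]

/-- **The orders `p^k` of `Γ_ℚ`-stable cyclic subgroups of `E(ℚ̄)` are bounded** (for elliptic
`E/ℚ`): distinct orders give non-isomorphic quotients `E/ℤx` — two CYCLIC `ℚ`-isogenies onto the
same curve have the same degree (`degree_eq_of_isCyclic`, from `End_ℚ(E) = ℤ`, tree
`not_hasRationalCM_holds`) —, and the quotients lie in the finitely many `ℚ`-isomorphism classes of
the isogeny class (Shafarevich, AEC IX.6.2, tree `finite_isogenyClass_holds`).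
[cite: SilvermanAEC2009, Cor. IX.6.2] -/
theorem bddAbove_setOf_stableCyclic :
    BddAbove {k : ℕ | ∃ x : V.geomPoints, addOrderOf x = p ^ k ∧
      ∀ σ : absoluteGaloisGroup ℚ, σ • x ∈ AddSubgroup.zmultiples x} := by
  have hp' : p.Prime := hp.out
  obtain ⟨F, hF⟩ := V.finite_isogenyClass_holds
  -- for each such `k`, a quotient `E/ℤx` and a representative in `F`
  have hrep : ∀ k ∈ {k : ℕ | ∃ x : V.geomPoints, addOrderOf x = p ^ k ∧
      ∀ σ : absoluteGaloisGroup ℚ, σ • x ∈ AddSubgroup.zmultiples x}, ∃ W₀ ∈ F,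
      ∃ (W : WeierstrassCurve ℚ) (_ : W.IsElliptic) (g : Isogeny V W) (C : VariableChange ℚ),
        g.degree = p ^ k ∧ g.IsCyclic ∧ C • W = W₀ := by
    rintro k ⟨x, hord, hstab⟩
    have hfin : (AddSubgroup.zmultiples x : Set V.geomPoints).Finite := by
      have : Finite (AddSubgroup.zmultiples x) := by
        apply Nat.finite_of_card_ne_zero
        rw [Nat.card_zmultiples, hord]; exact pow_ne_zero _ hp'.ne_zero
      exact Set.toFinite _
    have hst : ∀ (σ : absoluteGaloisGroup ℚ) (P : V.geomPoints), P ∈ AddSubgroup.zmultiples x →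
        σ • P ∈ AddSubgroup.zmultiples x := by
      intro σ P hP
      obtain ⟨n, rfl⟩ := AddSubgroup.mem_zmultiples_iff.mp hP
      rw [smul_comm σ n x]
      exact AddSubgroup.zsmul_mem _ (hstab σ) n
    obtain ⟨W, hW, -, g, hker⟩ := exists_minimal_isogeny_ker_eq (AddSubgroup.zmultiples x) hfin hst
    obtain ⟨C, hC⟩ := @hF _ hW ⟨g⟩
    obtain ⟨hdeg, hcyc⟩ := degree_eq_addOrderOf_of_ker_eq g hker
    exact ⟨C • W, hC, W, hW, g, C, by rw [hdeg, hord], hcyc, rfl⟩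
  choose! f hfF hf using hrep
  -- `k ↦ f k` is injective on the good `k`, into the finite `F`
  by_contra hnb
  have hinf : {k : ℕ | ∃ x : V.geomPoints, addOrderOf x = p ^ k ∧
      ∀ σ : absoluteGaloisGroup ℚ, σ • x ∈ AddSubgroup.zmultiples x}.Infinite :=
    fun hfin ↦ hnb hfin.bddAbove
  obtain ⟨k₁, hk₁, k₂, hk₂, hne, heq⟩ :=
    hinf.exists_ne_map_eq_of_mapsTo (f := f) (fun k hk ↦ (hfF k hk : f k ∈ (F : Set _))) F.finite_toSet
  obtain ⟨W₁, hW₁, g₁, C₁, hdeg₁, hcyc₁, hCW₁⟩ := hf k₁ hk₁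
  obtain ⟨W₂, hW₂, g₂, C₂, hdeg₂, hcyc₂, hCW₂⟩ := hf k₂ hk₂
  -- two cyclic isogenies `E → f k₁ = f k₂` of degrees `p^{k₁}`, `p^{k₂}`
  let ψ₁ : Isogeny V (C₁ • W₁) := (VariableChange.toIsogeny W₁ C₁).comp g₁
  let ψ₂ : Isogeny V (C₂ • W₂) := (VariableChange.toIsogeny W₂ C₂).comp g₂
  have hψ₁ : ψ₁.degree = p ^ k₁ ∧ ψ₁.IsCyclic := by
    constructor
    · unfold Isogeny.degree
      rw [Isogeny.ker_comp, VariableChange.ker_toIsogeny, AddMonoidHom.comap_bot]; exact hdeg₁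
    · unfold Isogeny.IsCyclic
      rw [Isogeny.ker_comp, VariableChange.ker_toIsogeny, AddMonoidHom.comap_bot]; exact hcyc₁
  have hψ₂ : ψ₂.degree = p ^ k₂ ∧ ψ₂.IsCyclic := by
    constructor
    · unfold Isogeny.degree
      rw [Isogeny.ker_comp, VariableChange.ker_toIsogeny, AddMonoidHom.comap_bot]; exact hdeg₂
    · unfold Isogeny.IsCyclic
      rw [Isogeny.ker_comp, VariableChange.ker_toIsogeny, AddMonoidHom.comap_bot]; exact hcyc₂
  have h12 : C₁ • W₁ = C₂ • W₂ := by rw [hCW₁, hCW₂, heq]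
  obtain ⟨hdeg₂', hcyc₂'⟩ := degree_cast h12.symm ψ₂
  haveI : (C₁ • W₁).IsElliptic := inferInstance
  have hdegeq := degree_eq_of_isCyclic ψ₁ (h12.symm ▸ ψ₂) hψ₁.2 (hcyc₂'.mpr hψ₂.2)
  rw [hψ₁.1, hdeg₂', hψ₂.1] at hdegeq
  exact hne (Nat.pow_right_injective hp'.two_le hdegeq)

end Bounded


/-! ## §4 Elementary helpers on subgroups of prime order -/

section Helpers

variable {A : Type*} [AddCommGroup A]

omit hp in
/-- A subgroup of prime order `p` is `ℤ·x` for some `x ≠ 0` of order `p`. [folklore] -/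
theorem exists_generator_of_prime_card {p : ℕ} [Fact p.Prime] (H : AddSubgroup A)
    (hH : Nat.card H = p) : ∃ x : A, x ∈ H ∧ x ≠ 0 ∧ addOrderOf x = p ∧ AddSubgroup.zmultiples x = H := by
  have hp : p.Prime := Fact.out
  haveI : Finite H := Nat.finite_of_card_ne_zero (by rw [hH]; exact hp.ne_zero)
  have hnt : Nontrivial H := by
    rw [← Finite.one_lt_card_iff_nontrivial, hH]; exact hp.one_lt
  obtain ⟨⟨x, hx⟩, hx0⟩ := exists_ne (0 : H)
  have hx0' : x ≠ 0 := fun h ↦ hx0 (Subtype.ext h)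
  have hord : addOrderOf x = p := by
    have hdvd : addOrderOf (⟨x, hx⟩ : H) ∣ p := by rw [← hH]; exact addOrderOf_dvd_natCard _
    rw [AddSubgroup.addOrderOf_mk] at hdvd
    rcases (Nat.dvd_prime hp).mp hdvd with h | h
    · exact absurd (AddMonoid.addOrderOf_eq_one_iff.mp h) hx0'
    · exact h
  refine ⟨x, hx, hx0', hord, ?_⟩
  exact AddSubgroup.eq_of_le_of_card_ge (AddSubgroup.zmultiples_le_of_mem hx)
    (by rw [hH, Nat.card_zmultiples, hord])

end Helpers

end Summit.BirchSwinnertonDyer.Rank1Residual.X1.StableCyclicQuotient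

end
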